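import Literature.AlgebraicGeometry.Frobenioids.ArithmeticFrobenioidThm64iVariants
import Literature.AlgebraicGeometry.Frobenioids.ArithmeticFrobenioidFrobeniusCompact
import Literature.AlgebraicGeometry.Frobenioids.Prop55SubRatStdRlfHolds
import Literature.AlgebraicGeometry.Frobenioids.UnitTrivializationBiratCompactComparison
import HarnessLib

/-!
# Frobenioids I, Theorem 6.4 (i) at `C_{K/F}`: the variants `C^un-tr`, `C^rlf`, `C^pf`, `(C^pf)^un-tr` are of
# RATIONALLY standard type (the «rationally» residue of sub-DAG row T64i/L11)

Mochizuki, *The geometry of Frobenioids I: the general theory*, Kyushu J. Math. **62** (2008)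
293–400, §6, Theorem 6.4 (i), kurims text p. 114 ll. 26–27 (statement) with proof p. 115 ll. 38–40: "Thus, we
conclude that `C` [hence also `C^pf`, `C^rlf`, `C^un-tr`, `(C^pf)^un-tr` — cf. Proposition 5.5, (iii)] is of
rationally standard type." [cite: MochizukiFrdI2008, Thm. 6.4 (i) p.114]

PROOF-ONLY sibling (cell abc-iut, layer L1, node `FrdI:Thm6.4(i)`, sub-DAG row T64i/L11; seat abc-iut-w5-d250)
of seat abc-iut-w4-d086's `ArithmeticFrobenioidThm64iVariants.lean`, which proves for each of the four
variants of the arithmetic Frobenioid `C_{K/F}` of Example 6.3 "Frobenioid, isotropic, not group-like, standard,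
model" and leaves the word «rationally» to the Prop. 5.5 (iii) slots BY NAME. Those slots are now theorems, so
the residue closes, at THE parameters (`rsParams`: THE birationalizations / unit-trivializations) and THE
support predicate `PrimarySupp` of Def. 2.4 (i)(d):
* `arith_untr_isOfRationallyStandardType` — `C_{K/F}^un-tr`: `FrdI.Prop55Sub.prop55iii_untr_ratStd_of` (Prop.
  5.5 (iii) "Finally", `C^un-tr` conjunct, seat abc-iut-w5-d250) fed with "`C_{K/F}` is of rationally standard
  type" (seat abc-iut-L6-t10's `arithFrobenioid_isOfRationallyStandardType_rsParams`, Thm. 6.4 (i) at THE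
  parameters: the Frobenius-compact object of `(C^un-tr)^birat` from `div 2`) and "not group-like";
* `arith_rlf_isOfRationallyStandardType` — `C_{K/F}^rlf`: the repaired slot `Prop55iii_untr_rlf_ratStd'`
  (`prop55iii_untr_rlf_ratStd'_holds`: (H), (N) and (K) = seat abc-iut-L1-t2's λ-rigidity transfer discharged) at
  the Frobenioid structure `arith_rlf_isFrobenioid` of seat abc-iut-w4-d086 / L6-t10;
* `arith_pf_isOfRationallyStandardType` — `C_{K/F}^pf`: seat abc-iut-w4-d108's
  `prop55iii_pf_ratStd_primarySupp_of_isOfIsotropicType` with its Def. 4.5 (iii)(b) binder supplied by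
  `Perfection.exists_isFrobeniusCompact_untrBirat_of_untr` (the λ-rigidity transfer up `Φ → Φ^pf`,
  `UnitTrivializationBiratCompactComparison.lean`) from the Frobenius-compact object of `(C^un-tr)^birat`;
* `arith_pfUntr_isOfRationallyStandardType` — `(C_{K/F}^pf)^un-tr`: the `C^un-tr` conjunct of Prop. 5.5 (iii)
  applied to the Frobenioid `C^pf` (`arith_pf_isFrobenioid`, not group-like by `arith_pf_not_isOfGroupLikeType`);
* `arith_variants_isOfRationallyStandardType` — the conjunction, i.e. the «rationally» residue of row T64i/L11.
No definitions; no statement of the paper is strengthened; nothing here bears on [IUTchIII] Cor. 3.12.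
-/

noncomputable section

namespace Literature.AlgebraicGeometry.Frobenioids

open CategoryTheory Opposite
open PreFrobenioid
open PreFrobenioidData (ofFunctor)

section Arith

variable (F : Type) [Field F] [NumberField F] (K : Type) [Field K] [Algebra F K] [IsGalois F K]

/-- **Thm. 6.4 (i): `C_{K/F}^un-tr` is of rationally standard type** (at THE parameters of the Frobenioid
`C^un-tr → F_Φ` and THE support `PrimarySupp`): Prop. 5.5 (iii) "Finally" (`C^un-tr` conjunct) applied to
"`C_{K/F}` is of rationally standard type and not of group-like type". [cite: MochizukiFrdI2008, Thm. 6.4 (i) p.114] -/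
theorem arith_untr_isOfRationallyStandardType :
    (ofFunctor (arithDivisorFunctor F K) (untrFunctor (arithFrobenioid_isFrobenioid F K))).IsOfRationallyStandardType
      (rsParams (isFrobenioid_untr (arithFrobenioid_isFrobenioid F K)) fun a 𝔭 => PrimarySupp a 𝔭) :=
  FrdI.Prop55Sub.prop55iii_untr_ratStd_of _ (arithFrobenioid_isFrobenioid F K) _
    (arith_not_isOfType_isGroupLikeObj F K) (arithFrobenioid_isOfRationallyStandardType_rsParams F K)

/-- **Thm. 6.4 (i): `C_{K/F}^rlf` is of rationally standard type** (THE realification over the perf-factorial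
`Φ`, at THE parameters of the Frobenioid `C^rlf → F_{Φ^rlf}` and THE support `PrimarySupp`): the repaired
Prop. 5.5 (iii) slot `Prop55iii_untr_rlf_ratStd'` (PROVED) at `C_{K/F}`. [cite: MochizukiFrdI2008, Thm. 6.4 (i) p.114] -/
theorem arith_rlf_isOfRationallyStandardType :
    (ofFunctor _ (rlfToElem
        (ModelFrobenioid.toElem (arithDivisorFunctor F K) (unitsFunctor F K) (divNatTrans F K))
        (arith_isPerfFactorialOn F K))).IsOfRationallyStandardType
      (rsParams (arith_rlf_isFrobenioid F K) fun a 𝔭 => PrimarySupp a 𝔭) :=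
  (FrdI.Prop55Sub.prop55iii_untr_rlf_ratStd'_holds _ (arithFrobenioid_isFrobenioid F K)
      (arith_isPerfFactorialOn F K) (arith_isOfType_isFrobeniusIsotropic F K)
      (arith_isOfType_isFrobeniusNormalized F K) (arith_not_isOfType_isGroupLikeObj F K)
      (arithFrobenioid_isOfRationallyStandardType_rsParams F K)).2 (arith_rlf_isFrobenioid F K)

/-- **Thm. 6.4 (i): `C_{K/F}^pf` is of rationally standard type** (at THE parameters of the Frobenioid
`C^pf → F_{Φ^pf}` and THE support `PrimarySupp` on `Φ` and on `Φ^pf`): the Prop. 5.5 (iii) perfection slot at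
the canonical support (seat abc-iut-w4-d108), its Def. 4.5 (iii)(b) binder fed by the λ-rigidity transfer up
`Φ → Φ^pf` from the Frobenius-compact object of `(C_{K/F}^un-tr)^birat`. [cite: MochizukiFrdI2008, Thm. 6.4 (i) p.114] -/
theorem arith_pf_isOfRationallyStandardType :
    (ofFunctor _ (Perfection.ops (arithFrobenioid_isFrobenioid F K)).toFunctor).IsOfRationallyStandardType
      (rsParams (arith_pf_isFrobenioid F K) fun a 𝔭 => PrimarySupp a 𝔭) :=
  FrdI.Prop55Sub.prop55iii_pf_ratStd_primarySupp_of_isOfIsotropicType (arithFrobenioid_isFrobenioid F K)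
    (arith_isOfIsotropicType F K)
    (fun hPf => Perfection.exists_isFrobeniusCompact_untrBirat_of_untr (arithFrobenioid_isFrobenioid F K) hPf
      (arith_isOfType_isFrobeniusIsotropic F K) (arithFrobenioid_exists_isFrobeniusCompact F K))
    (arith_isOfType_isFrobeniusIsotropic F K) (arith_isOfType_isFrobeniusNormalized F K)
    (arith_pf_isFrobenioid F K) (arithFrobenioid_isOfRationallyStandardType_rsParams F K)

/-- `C_{K/F}^pf` is not of group-like type, in the `IsOfType (IsGroupLikeObj _)` form (from seat
abc-iut-w4-d086's `arith_pf_not_isOfGroupLikeType`). [cite: MochizukiFrdI2008, Thm. 6.4 (i) p.115] -/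
theorem arith_pf_not_isOfType_isGroupLikeObj :
    ¬ IsOfType (IsGroupLikeObj (Perfection.ops (arithFrobenioid_isFrobenioid F K)).toFunctor) := by
  intro h
  refine arith_pf_not_isOfGroupLikeType F K ⟨fun X => ?_⟩
  exact (PreFrobenioidData.ofFunctor_isGroupLikeObj
    (Perfection.ops (arithFrobenioid_isFrobenioid F K)).toFunctor X).mpr (h X)

/-- **Thm. 6.4 (i): `(C_{K/F}^pf)^un-tr` is of rationally standard type** (at THE parameters, support
`PrimarySupp`): the `C^un-tr` conjunct of Prop. 5.5 (iii) "Finally" applied to the Frobenioid `C_{K/F}^pf`,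
which is of rationally standard type and not of group-like type. [cite: MochizukiFrdI2008, Thm. 6.4 (i) p.114] -/
theorem arith_pfUntr_isOfRationallyStandardType :
    (ofFunctor _ (untrFunctor (arith_pf_isFrobenioid F K))).IsOfRationallyStandardType
      (rsParams (isFrobenioid_untr (arith_pf_isFrobenioid F K)) fun a 𝔭 => PrimarySupp a 𝔭) :=
  FrdI.Prop55Sub.prop55iii_untr_ratStd_of _ (arith_pf_isFrobenioid F K) _
    (arith_pf_not_isOfType_isGroupLikeObj F K) (arith_pf_isOfRationallyStandardType F K)

/-- **Thm. 6.4 (i) p. 115 ll. 38–40, the «rationally» residue of row T64i/L11, in one conjunction**: each of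
`C_{K/F}`, `C_{K/F}^un-tr`, `C_{K/F}^rlf`, `C_{K/F}^pf`, `(C_{K/F}^pf)^un-tr` is of rationally standard type (at THE
parameters and THE support `PrimarySupp`). [cite: MochizukiFrdI2008, Thm. 6.4 (i) p.114] -/
theorem arith_variants_isOfRationallyStandardType :
    (arithFrobenioidOps F K).IsOfRationallyStandardType
        (rsParams (arithFrobenioid_isFrobenioid F K) fun a 𝔭 => PrimarySupp a 𝔭) ∧
      (ofFunctor (arithDivisorFunctor F K)
          (untrFunctor (arithFrobenioid_isFrobenioid F K))).IsOfRationallyStandardType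
        (rsParams (isFrobenioid_untr (arithFrobenioid_isFrobenioid F K)) fun a 𝔭 => PrimarySupp a 𝔭) ∧
      (ofFunctor _ (rlfToElem
          (ModelFrobenioid.toElem (arithDivisorFunctor F K) (unitsFunctor F K) (divNatTrans F K))
          (arith_isPerfFactorialOn F K))).IsOfRationallyStandardType
        (rsParams (arith_rlf_isFrobenioid F K) fun a 𝔭 => PrimarySupp a 𝔭) ∧
      (ofFunctor _ (Perfection.ops (arithFrobenioid_isFrobenioid F K)).toFunctor).IsOfRationallyStandardType
        (rsParams (arith_pf_isFrobenioid F K) fun a 𝔭 => PrimarySupp a 𝔭) ∧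
      (ofFunctor _ (untrFunctor (arith_pf_isFrobenioid F K))).IsOfRationallyStandardType
        (rsParams (isFrobenioid_untr (arith_pf_isFrobenioid F K)) fun a 𝔭 => PrimarySupp a 𝔭) :=
  ⟨arithFrobenioid_isOfRationallyStandardType_rsParams F K, arith_untr_isOfRationallyStandardType F K,
    arith_rlf_isOfRationallyStandardType F K, arith_pf_isOfRationallyStandardType F K,
    arith_pfUntr_isOfRationallyStandardType F K⟩

end Arith

end Literature.AlgebraicGeometry.Frobenioids

end
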